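import Literature.Combinatorics.Additive.TupleKneserBound
import HarnessLib

/-!
# Spread left-invariant couplings on `d`-tuples act almost lazily on pure degree `d` (Keevash–Lifshitz 2023, §2.4–§2.6, Lemma 2.11)

Source: P. Keevash, N. Lifshitz, *Sharp hypercontractivity for symmetric groups and its applications*,
arXiv:2307.15030 [KeevashLifshitz2023], §2.4 "Spread couplings" (Def. 2.10, Lemma 2.11), §2.5 "The
staying decomposition" (Lemmas 2.13–2.15), §2.6 (proof of Lemma 2.14); held text
`paper:arxiv-2307.15030` pp. 14–16 read first-hand (cell pnp-psdrank, lit g20, 2026-08-27).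

Second brick of the programme (cell memo LIT-26, Milestone M) to prove the `S_n` layer of
Keevash–Lifshitz Thm 3.1 ⇒ 1.8 (tree facts `GlobalLevelDInequalityBiglobal`, `GlobalLevelDInequality`).
It proves the spectral heart of the junta lower bound (Lemma 2.9): a LEFT-INVARIANT kernel `ν` on
`[n]_d × [n]_d` (`ν(τa, τb) = ν(a,b)` for all `τ ∈ S_n`) which is POINTWISE `p`-SPREAD,
`ν(a,b) ≤ ν(a,a) · p^{#{i : a_i ≠ b_i}}`, acts on functions of pure top degree
(`Tuple.IsPureTop`, brick `TupleKneserBound`) almost as the multiple `ν(a,a)` of the identity: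

* `lmap τ` — the left action `(τ a)_i = τ(a_i)`; `IsLeftInvariant ν`; patterns are left-invariant
  (`pat_lmap`); `S_n` is transitive on `[n]_d` and on each pattern class (`exists_perm_lmap_eq`,
  `exists_perm_fix_lmap_eq`, from Mathlib's `Finset.exists_equiv_extend_of_card_eq`), hence a
  left-invariant kernel is CONSTANT ON PATTERN CLASSES (`kernel_eq_of_pat_eq`) and on the diagonal
  (`kernel_diag_eq`) — the exact content of "by `S_n`-invariance" in the proofs of Lemmas 2.13/2.14;
* `moved a b = #{i : a_i ≠ b_i}` is a function of the pattern (`moved_eq_mvp`);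
* **Lemma 2.11′** (`sum_sq_offDiag_le`, `abs_offDiag_form_le`, `quadratic_form_ge`): for `ν ≥ 0`
  left-invariant and pointwise `p`-spread and `g` of pure top degree,
  `Σ_a (Σ_{b ≠ a} ν(a,b) g(b))² ≤ (ν(a,a) · ε)² Σ_b g(b)²`, hence
  `Σ_{a,b} ν(a,b) g(a) g(b) ≥ (1 − ε) · ν(a,a) · Σ_a g(a)²`, with
  `ε = patExtSum d p := Σ_{π ≠ id} p^{m(π)} · #ext π` (Minkowski over the pattern classes, each class
  priced by `TupleKneserBound.sum_sq_classSum_le`);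
* the COUNT `patExtSum_le` : `ε ≤ Σ_{m=1}^{d} (2pd)^m` (pairs `(π, ρ ∈ ext π)` ↔ pairs `(F, ρ)` with
  `m(π) = #(F ∪ supp ρ)`; a fibre `F ∪ supp ρ = M` has at most `2^{|M|} · |M|!` elements; `C(d,m) m! ≤ d^m`),
  and `patExtSum_le_of_le` : `ε ≤ 4pd` once `2pd ≤ 1/2`. In the paper's use (`p = O(1/n)`,
  `n ≥ 10⁵ d`) this gives `⟨T(ν) g, g⟩ ≥ 0.999 p_lazy ‖g‖²`, i.e. Lemma 2.11 with room to spare.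

DEVIATIONS FROM PRINT (declared). (1) Def. 2.10 prints "`ν(a,b) ≤ p_lazy p^{|{i : a_i ≠ b_i}|}`" with
`p_lazy = ν({a = b}) = |[n]_d| ν(a,a)`, but the proof of Lemma 2.14 (p. 15: "by spreadness of `ν`,
`ν(E'_{S'}) ν_{S'}(a',b') = ν(a,b) ≤ (10/n)^{d−|S'|} ν(a,a)`") uses the POINTWISE form
`ν(a,b) ≤ ν(a,a) p^{…}`, which is what we assume (the forgetful coupling of §2.1 satisfies it with
`p = 2/n`; next brick). (2) The staying decomposition by the set `stay(a,b)` (Lemmas 2.13–2.15, two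
Cauchy–Schwarz steps and the count of Lemma 2.14, whose `|S∖S'|!·n^{d−|S|}` undercounts by the factor
`C(r+u, r)` — harmless) is replaced by the finer PATTERN decomposition of `TupleKneserBound`, on which a
left-invariant kernel is constant, so that each class is priced exactly; the resulting constant
`Σ_{m≥1} (2pd)^m` is better than the printed `0.01 p_lazy`. Counting (un-normalised) sums throughout: the
paper's `⟨T(ν) g, g⟩ = E_ν[g(a)g(b)] = Σ_{a,b} ν(a,b) g(a) g(b)` for a probability kernel, and
`p_lazy ‖g‖₂² = |[n]_d| ν(a,a) · |[n]_d|⁻¹ Σ_a g(a)² = ν(a,a) Σ_a g(a)²`, so `quadratic_form_ge` IS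
"`⟨T g, g⟩ ≥ (1 − ε) p_lazy ‖g‖₂²`" verbatim.

NOT here: the coupling `C` of §2.1, eq. (fg)/(lazy), Lemma 2.9 itself, anything on `S_n` or `[n]^n`
(next bricks). No facts, no instances, no notation; standard axioms. WHAT THIS IS NOT: not a proof of
Theorem 1.8/3.1; nothing about matchings or psd rank; no P-vs-NP content.
-/

noncomputable section

namespace Literature.Combinatorics.Additive.KeevashLifshitz

namespace Tuple

open Finset

variable {α : Type*} [Fintype α] [DecidableEq α] {d : ℕ}

/-! ## The left action of `S_n` on tuples; left-invariant kernels -/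

/-- The left action of a permutation `τ` of the values on tuples: `(τ a)_i = τ (a_i)`.
[cite: KeevashLifshitz2023, §1.1 (the left action `L_σ`) and §2.4] -/
def lmap (τ : Equiv.Perm α) : (Fin d ↪ α) ≃ (Fin d ↪ α) where
  toFun a := a.trans τ.toEmbedding
  invFun a := a.trans τ.symm.toEmbedding
  left_inv a := by ext i; simp
  right_inv a := by ext i; simp

omit [Fintype α] [DecidableEq α] in
/-- [cite: KeevashLifshitz2023, §1.1] -/
@[simp] theorem lmap_apply (τ : Equiv.Perm α) (a : Fin d ↪ α) (i : Fin d) : lmap τ a i = τ (a i) := rfl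

/-- A kernel on tuples is **left-invariant** (`S_n`-invariant): `ν(τa, τb) = ν(a, b)`.
[cite: KeevashLifshitz2023, §2.4 ("`ν(L_σ a, L_σ b) = ν(a,b)` for all `σ ∈ S_n`")] -/
def IsLeftInvariant (ν : (Fin d ↪ α) → (Fin d ↪ α) → ℝ) : Prop :=
  ∀ (τ : Equiv.Perm α) (a b : Fin d ↪ α), ν (lmap τ a) (lmap τ b) = ν a b

omit [Fintype α] in
/-- Patterns are invariant under the left action. [cite: KeevashLifshitz2023, Def. 2.12] -/
theorem pat_lmap (τ : Equiv.Perm α) (a b : Fin d ↪ α) : pat (lmap τ a) (lmap τ b) = pat a b := by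
  funext i
  cases h : pat a b i with
  | none =>
    rw [pat_eq_none_iff] at h ⊢
    intro j
    simp only [lmap_apply]
    exact fun e => h j (τ.injective e)
  | some j =>
    rw [pat_eq_some_iff] at h ⊢
    simp only [lmap_apply, h]

/-- Extension of a partial injection to a permutation of a finite type (Mathlib's
`Finset.exists_equiv_extend_of_card_eq`, repackaged). [folklore] -/
private theorem exists_perm_extend (s : Finset α) (f : α → α) (hf : Set.InjOn f s) :
    ∃ τ : Equiv.Perm α, ∀ x ∈ s, τ x = f x := by
  classical
  obtain ⟨g, hg⟩ := Finset.exists_equiv_extend_of_card_eq (t := (univ : Finset α))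
    (by rw [card_univ]) (s := s) (f := f) (by intro x _; exact mem_univ _) hf
  refine ⟨g.trans (Equiv.subtypeUnivEquiv (fun x => mem_univ x)), fun x hx => ?_⟩
  simp only [Equiv.trans_apply]
  rw [← hg x hx]
  rfl

/-- `S_n` acts transitively on `[n]_d`. [cite: KeevashLifshitz2023, §2.4 ("both marginals of `ν` are uniform")] -/
theorem exists_perm_lmap_eq (a a' : Fin d ↪ α) : ∃ τ : Equiv.Perm α, lmap τ a = a' := by
  classical
  -- the partial map `a i ↦ a' i` on the range of `a`
  let f : α → α := fun x => if h : ∃ i, a i = x then a' h.choose else x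
  have hf : ∀ i, f (a i) = a' i := by
    intro i
    have h : ∃ j, a j = a i := ⟨i, rfl⟩
    simp only [f, dif_pos h]
    congr 1
    exact a.injective h.choose_spec
  obtain ⟨τ, hτ⟩ := exists_perm_extend (univ.image a) f (by
    intro x hx y hy e
    obtain ⟨i, -, rfl⟩ := mem_image.1 hx
    obtain ⟨j, -, rfl⟩ := mem_image.1 hy
    rw [hf, hf] at e
    rw [a'.injective e])
  refine ⟨τ, ?_⟩
  ext i
  rw [lmap_apply, hτ _ (mem_image_of_mem a (mem_univ i)), hf]

/-- The stabiliser of `a` acts transitively on each pattern class at `a`: if `b, b'` have the same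
pattern relative to `a` there is `τ` fixing `a` with `τ b = b'`.
[cite: KeevashLifshitz2023, §2.6 ("`ν(A_S | E_{S'}) = ν(A_S | E'_{S'})` by `S_n`-invariance")] -/
theorem exists_perm_fix_lmap_eq {a b b' : Fin d ↪ α} (h : pat a b = pat a b') :
    ∃ τ : Equiv.Perm α, lmap τ a = a ∧ lmap τ b = b' := by
  classical
  let f : α → α := fun x => if hx : ∃ i, b i = x then b' hx.choose else x
  have hfb : ∀ i, f (b i) = b' i := by
    intro i
    have hx : ∃ j, b j = b i := ⟨i, rfl⟩
    simp only [f, dif_pos hx]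
    congr 1
    exact b.injective hx.choose_spec
  have hfa : ∀ j, f (a j) = a j := by
    intro j
    by_cases hx : ∃ i, b i = a j
    · obtain ⟨i, hi⟩ := hx
      rw [← hi, hfb]
      -- `pat a b i = some j`, hence `pat a b' i = some j`
      have h1 : pat a b i = some j := pat_eq_some_iff.2 hi.symm
      rw [h] at h1
      exact (pat_eq_some_iff.1 h1).symm.trans hi.symm
    · simp only [f, dif_neg hx]
  obtain ⟨τ, hτ⟩ := exists_perm_extend (univ.image a ∪ univ.image b) f (by
    intro x hx y hy e
    -- `f` is injective on `range a ∪ range b`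
    have key : ∀ z ∈ univ.image a ∪ univ.image b, ∀ i, f z = b' i → z = b i := by
      intro z hz i hz'
      rcases mem_union.1 hz with hz | hz
      · obtain ⟨j, -, rfl⟩ := mem_image.1 hz
        rw [hfa] at hz'
        -- `a j = b' i` : then `pat a b' i = some j = pat a b i`
        have h1 : pat a b' i = some j := pat_eq_some_iff.2 hz'
        rw [← h] at h1
        exact pat_eq_some_iff.1 h1
      · obtain ⟨j, -, rfl⟩ := mem_image.1 hz
        rw [hfb] at hz'
        rw [b'.injective hz']
    rcases mem_union.1 hy with hy' | hy'
    · obtain ⟨j, -, rfl⟩ := mem_image.1 hy'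
      rw [hfa] at e
      -- `f x = a j`
      rcases mem_union.1 hx with hx' | hx'
      · obtain ⟨j', -, rfl⟩ := mem_image.1 hx'
        rw [hfa] at e; exact e
      · obtain ⟨i, -, rfl⟩ := mem_image.1 hx'
        rw [hfb] at e
        -- `b' i = a j` ⇒ `b i = a j`
        have h1 : pat a b' i = some j := pat_eq_some_iff.2 e.symm
        rw [← h] at h1
        exact (pat_eq_some_iff.1 h1).symm
    · obtain ⟨i, -, rfl⟩ := mem_image.1 hy'
      rw [hfb] at e
      exact key x hx i e)
  refine ⟨τ, ?_, ?_⟩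
  · ext j
    rw [lmap_apply, hτ _ (mem_union_left _ (mem_image_of_mem a (mem_univ j))), hfa]
  · ext i
    rw [lmap_apply, hτ _ (mem_union_right _ (mem_image_of_mem b (mem_univ i))), hfb]

/-- A left-invariant kernel is **constant on pattern classes**.
[cite: KeevashLifshitz2023, Lemma 2.13 ("`P_{b∼N_ν(a)}[A_S] = α_S` independent of `a`") and §2.6] -/
theorem kernel_eq_of_pat_eq {ν : (Fin d ↪ α) → (Fin d ↪ α) → ℝ} (hν : IsLeftInvariant ν)
    {a b b' : Fin d ↪ α} (h : pat a b = pat a b') : ν a b = ν a b' := by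
  obtain ⟨τ, ha, hb⟩ := exists_perm_fix_lmap_eq h
  rw [← hν τ a b, ha, hb]

/-- A left-invariant kernel is constant on the diagonal (`p_lazy = |[n]_d| ν(a,a)` "does not depend on
`a`"). [cite: KeevashLifshitz2023, §2.4] -/
theorem kernel_diag_eq {ν : (Fin d ↪ α) → (Fin d ↪ α) → ℝ} (hν : IsLeftInvariant ν)
    (a a' : Fin d ↪ α) : ν a a = ν a' a' := by
  obtain ⟨τ, h⟩ := exists_perm_lmap_eq a a'
  rw [← h, hν]

/-! ## Moved coordinates -/

/-- The number of coordinates where `a` and `b` differ. [cite: KeevashLifshitz2023, Def. 2.10] -/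
def moved (a b : Fin d ↪ α) : ℕ := (univ.filter fun i => a i ≠ b i).card

/-- The number of non-fixed coordinates of a pattern. [cite: KeevashLifshitz2023, Def. 2.10] -/
def mvp (π : Fin d → Option (Fin d)) : ℕ := (univ.filter fun i => π i ≠ some i).card

omit [Fintype α] in
/-- `#{i : a_i ≠ b_i}` depends only on the pattern of `b` relative to `a`. [cite: KeevashLifshitz2023, Def. 2.10/2.12] -/
theorem moved_eq_mvp {a b : Fin d ↪ α} {π : Fin d → Option (Fin d)} (h : pat a b = π) :
    moved a b = mvp π := by
  unfold moved mvp
  congr 1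
  ext i
  simp only [mem_filter, mem_univ, true_and, ← h]
  rw [not_iff_not]
  exact (pat_eq_some_iff (a := a) (b := b) (i := i) (j := i)).symm

omit [Fintype α] [DecidableEq α] in
/-- The identity pattern moves nothing. [cite: KeevashLifshitz2023, Def. 2.10] -/
theorem mvp_id : mvp (fun i : Fin d => some i) = 0 := by
  simp [mvp]

/-! ## The error functional and its count -/

/-- The **pattern–extension sum** `ε(d, p) = Σ_{π ≠ id} p^{m(π)} · #ext π`, the error constant of
Lemma 2.11′. [cite: KeevashLifshitz2023, Lemma 2.11 and Lemma 2.14] -/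
def patExtSum (d : ℕ) (p : ℝ) : ℝ :=
  ∑ π ∈ (univ : Finset (Fin d → Option (Fin d))).erase (fun i => some i), p ^ mvp π * ((ext π).card : ℝ)

omit [Fintype α] [DecidableEq α] in
/-- [cite: KeevashLifshitz2023, Lemma 2.11] -/
theorem patExtSum_nonneg (d : ℕ) {p : ℝ} (hp : 0 ≤ p) : 0 ≤ patExtSum d p :=
  sum_nonneg fun _ _ => by positivity

/-- The pattern with free set `F` whose pinned part is read off from a permutation `ρ`.
[cite: KeevashLifshitz2023, §2.5] -/
def patOf (F : Finset (Fin d)) (ρ : Equiv.Perm (Fin d)) : Fin d → Option (Fin d) :=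
  fun i => if i ∈ F then none else some (ρ i)

omit [Fintype α] [DecidableEq α] in
/-- [cite: KeevashLifshitz2023, §2.5] -/
theorem mem_ext_patOf (F : Finset (Fin d)) (ρ : Equiv.Perm (Fin d)) : ρ ∈ ext (patOf F ρ) := by
  rw [mem_ext]
  intro i j h
  unfold patOf at h
  split_ifs at h
  simpa using h

omit [Fintype α] [DecidableEq α] in
/-- [cite: KeevashLifshitz2023, §2.5] -/
theorem freeSet_patOf (F : Finset (Fin d)) (ρ : Equiv.Perm (Fin d)) : freeSet (patOf F ρ) = F := by
  ext i
  rw [mem_freeSet]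
  unfold patOf
  split_ifs with h <;> simp [h]

omit [Fintype α] [DecidableEq α] in
/-- A pattern extended by `ρ` is recovered from its free set and `ρ`. [cite: KeevashLifshitz2023, §2.5] -/
theorem patOf_freeSet {π : Fin d → Option (Fin d)} {ρ : Equiv.Perm (Fin d)} (h : ρ ∈ ext π) :
    patOf (freeSet π) ρ = π := by
  rw [mem_ext] at h
  funext i
  unfold patOf
  split_ifs with hi
  · exact (mem_freeSet.1 hi).symm
  · rw [mem_freeSet] at hi
    cases hπ : π i with
    | none => exact (hi hπ).elim
    | some j => rw [h i j hπ]

omit [Fintype α] [DecidableEq α] in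
/-- The moved count of `patOf F ρ` is `#(F ∪ supp ρ)`. [cite: KeevashLifshitz2023, §2.5/§2.6] -/
theorem mvp_patOf (F : Finset (Fin d)) (ρ : Equiv.Perm (Fin d)) : mvp (patOf F ρ) = (F ∪ ρ.support).card := by
  unfold mvp
  congr 1
  ext i
  simp only [mem_filter, mem_univ, true_and, mem_union, Equiv.Perm.mem_support, patOf]
  split_ifs with h <;> simp [h]

omit [Fintype α] [DecidableEq α] in
/-- **Reparametrisation**: `Σ_π p^{m(π)} #ext π = Σ_ρ Σ_F p^{#(F ∪ supp ρ)}` (all patterns, including the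
identity). [cite: KeevashLifshitz2023, Lemma 2.14 (the decomposition (α_S) by `E_{S'}`)] -/
theorem sum_pow_mvp_card_ext (p : ℝ) :
    ∑ π : Fin d → Option (Fin d), p ^ mvp π * ((ext π).card : ℝ) =
      ∑ ρ : Equiv.Perm (Fin d), ∑ F : Finset (Fin d), p ^ (F ∪ ρ.support).card := by
  classical
  -- write `#ext π` as a sum and swap
  have h1 : ∀ π : Fin d → Option (Fin d), p ^ mvp π * ((ext π).card : ℝ) =
      ∑ ρ ∈ ext π, p ^ mvp π := by
    intro π; rw [sum_const, nsmul_eq_mul, mul_comm]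
  simp_rw [h1]
  rw [show (∑ π : Fin d → Option (Fin d), ∑ ρ ∈ ext π, p ^ mvp π) =
      ∑ π : Fin d → Option (Fin d), ∑ ρ : Equiv.Perm (Fin d), if ρ ∈ ext π then p ^ mvp π else 0 from
    sum_congr rfl fun π _ => by rw [sum_ite_mem, univ_inter]]
  rw [sum_comm]
  refine sum_congr rfl fun ρ _ => ?_
  rw [← sum_filter]
  -- bijection `π ↦ freeSet π` between `{π : ρ ∈ ext π}` and all `F`
  refine sum_nbij' (fun π => freeSet π) (fun F => patOf F ρ) (fun _ _ => mem_univ _)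
    (fun F _ => by rw [mem_filter]; exact ⟨mem_univ _, mem_ext_patOf F ρ⟩)
    (fun π hπ => by rw [mem_filter] at hπ; exact patOf_freeSet hπ.2)
    (fun F _ => freeSet_patOf F ρ)
    (fun π hπ => ?_)
  rw [mem_filter] at hπ
  rw [← mvp_patOf, patOf_freeSet hπ.2]

omit [Fintype α] [DecidableEq α] in
/-- The permutations supported in `M` number `|M|!`. [folklore] -/
private theorem card_perm_support_subset (M : Finset (Fin d)) :
    ((univ : Finset (Equiv.Perm (Fin d))).filter (fun ρ => ρ.support ⊆ M)).card = M.card.factorial := by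
  classical
  have : ((univ : Finset (Equiv.Perm (Fin d))).filter (fun ρ => ρ.support ⊆ M)).card =
      Fintype.card {f : Equiv.Perm (Fin d) // ∀ a, ¬ a ∈ M → f a = a} := by
    rw [Fintype.card_subtype]
    congr 1
    ext ρ
    simp only [mem_filter, mem_univ, true_and]
    constructor
    · intro h a ha
      by_contra hne
      exact ha (h (Equiv.Perm.mem_support.2 hne))
    · intro h a ha
      rw [Equiv.Perm.mem_support] at ha
      by_contra hM
      exact ha (h a hM)
  rw [this, ← Fintype.card_congr (Equiv.Perm.subtypeEquivSubtypePerm (· ∈ M)), Fintype.card_perm,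
    Fintype.card_coe]

omit [Fintype α] [DecidableEq α] in
/-- **The count** (our Lemma 2.14): `Σ_{(F,ρ)} p^{#(F ∪ supp ρ)} ≤ Σ_{m=0}^{d} C(d,m) m! (2p)^m`.
[cite: KeevashLifshitz2023, Lemma 2.14] -/
theorem sum_sum_pow_card_union_le {p : ℝ} (hp : 0 ≤ p) :
    ∑ ρ : Equiv.Perm (Fin d), ∑ F : Finset (Fin d), p ^ (F ∪ ρ.support).card ≤
      ∑ M : Finset (Fin d), (M.card.factorial : ℝ) * (2 * p) ^ M.card := by
  classical
  -- group the pairs by `M = F ∪ supp ρ`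
  have hprod : (∑ ρ : Equiv.Perm (Fin d), ∑ F : Finset (Fin d), p ^ (F ∪ ρ.support).card) =
      ∑ x ∈ (univ : Finset (Equiv.Perm (Fin d))) ×ˢ (univ : Finset (Finset (Fin d))),
        p ^ (x.2 ∪ x.1.support).card := by
    rw [sum_product]
  rw [hprod]
  rw [← sum_fiberwise (s := (univ : Finset (Equiv.Perm (Fin d))) ×ˢ (univ : Finset (Finset (Fin d))))
    (g := fun x => x.2 ∪ x.1.support) (f := fun x => p ^ (x.2 ∪ x.1.support).card)]
  refine sum_le_sum fun M _ => ?_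
  -- on the fibre the summand is the constant `p^{|M|}`
  rw [show (∑ x ∈ (univ ×ˢ univ : Finset (Equiv.Perm (Fin d) × Finset (Fin d))) with
        x.2 ∪ x.1.support = M, p ^ (x.2 ∪ x.1.support).card) =
      ∑ x ∈ (univ ×ˢ univ : Finset (Equiv.Perm (Fin d) × Finset (Fin d))) with
        x.2 ∪ x.1.support = M, p ^ M.card from sum_congr rfl fun x hx => by
          rw [mem_filter] at hx; rw [hx.2]]
  rw [sum_const, nsmul_eq_mul]
  -- the fibre injects into `{ρ : supp ρ ⊆ M} × powerset M`
  have hcard : ((univ ×ˢ univ : Finset (Equiv.Perm (Fin d) × Finset (Fin d))).filter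
      (fun x => x.2 ∪ x.1.support = M)).card ≤ M.card.factorial * 2 ^ M.card := by
    calc _ ≤ (((univ : Finset (Equiv.Perm (Fin d))).filter (fun ρ => ρ.support ⊆ M)) ×ˢ
              M.powerset).card := by
          refine card_le_card fun x hx => ?_
          rw [mem_filter] at hx
          rw [mem_product, mem_filter, mem_powerset]
          refine ⟨⟨mem_univ _, ?_⟩, ?_⟩
          · rw [← hx.2]; exact subset_union_right
          · rw [← hx.2]; exact subset_union_left
      _ = M.card.factorial * 2 ^ M.card := by
          rw [card_product, card_perm_support_subset, card_powerset]
  calc (((univ ×ˢ univ : Finset (Equiv.Perm (Fin d) × Finset (Fin d))).filter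
        (fun x => x.2 ∪ x.1.support = M)).card : ℝ) * p ^ M.card
      ≤ ((M.card.factorial * 2 ^ M.card : ℕ) : ℝ) * p ^ M.card := by
        gcongr
    _ = (M.card.factorial : ℝ) * (2 * p) ^ M.card := by push_cast; ring

omit [Fintype α] [DecidableEq α] in
/-- `Σ_M |M|!·q^{|M|} = Σ_m C(d,m) m! q^m ≤ Σ_{m=0}^{d} (qd)^m` (`C(d,m) m! = (d)_m ≤ d^m`).
[cite: KeevashLifshitz2023, Lemma 2.14 (the final geometric sum)] -/
theorem sum_card_factorial_mul_pow_le {q : ℝ} (hq : 0 ≤ q) :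
    ∑ M : Finset (Fin d), (M.card.factorial : ℝ) * q ^ M.card ≤ ∑ m ∈ range (d + 1), (q * d) ^ m := by
  classical
  rw [← sum_fiberwise_of_maps_to (s := (univ : Finset (Finset (Fin d)))) (t := range (d + 1))
    (g := fun M => M.card) (fun M _ => by
      rw [mem_range]
      have : M.card ≤ d := by simpa using card_le_univ M
      omega)]
  refine sum_le_sum fun m hm => ?_
  rw [show (∑ M ∈ (univ : Finset (Finset (Fin d))) with M.card = m, (M.card.factorial : ℝ) * q ^ M.card) =
      ∑ M ∈ (univ : Finset (Finset (Fin d))) with M.card = m, (m.factorial : ℝ) * q ^ m from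
    sum_congr rfl fun M hM => by rw [mem_filter] at hM; rw [hM.2]]
  rw [sum_const, nsmul_eq_mul]
  have hcount : ((univ : Finset (Finset (Fin d))).filter (fun M => M.card = m)).card = d.choose m := by
    rw [← powerset_univ, ← powersetCard_eq_filter, card_powersetCard, card_univ, Fintype.card_fin]
  rw [hcount]
  calc (d.choose m : ℝ) * ((m.factorial : ℝ) * q ^ m) = (d.descFactorial m : ℝ) * q ^ m := by
        rw [Nat.descFactorial_eq_factorial_mul_choose]; push_cast; ring
    _ ≤ ((d : ℝ) ^ m) * q ^ m := by
        gcongr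
        exact_mod_cast Nat.descFactorial_le_pow d m
    _ = (q * d) ^ m := by rw [mul_pow]; ring

omit [Fintype α] [DecidableEq α] in
/-- **The error constant is a geometric sum**: `1 + ε(d,p) ≤ Σ_{m=0}^{d} (2pd)^m`.
[cite: KeevashLifshitz2023, Lemma 2.14 and proof of Lemma 2.11] -/
theorem one_add_patExtSum_le {p : ℝ} (hp : 0 ≤ p) :
    1 + patExtSum d p ≤ ∑ m ∈ range (d + 1), (2 * p * d) ^ m := by
  classical
  unfold patExtSum
  have hid : p ^ mvp (fun i : Fin d => some i) * ((ext (fun i : Fin d => some i)).card : ℝ) = 1 := by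
    rw [mvp_id, pow_zero, one_mul]
    have : ext (fun i : Fin d => some i) = {1} := by
      ext ρ
      rw [mem_ext, mem_singleton]
      constructor
      · intro h; ext i; simpa using congr_arg Fin.val (h i i rfl)
      · rintro rfl i j h; simpa using h
    rw [this, card_singleton, Nat.cast_one]
  have htot := sum_pow_mvp_card_ext (d := d) p
  rw [← add_sum_erase _ _ (mem_univ (fun i : Fin d => some i)), hid] at htot
  rw [htot]
  exact (sum_sum_pow_card_union_le hp).trans (sum_card_factorial_mul_pow_le (by positivity))

omit [Fintype α] [DecidableEq α] in
/-- **Usable form**: if `2pd ≤ 1/2` then `ε(d,p) ≤ 4pd` (in the paper `p = O(1/n)`, `n ≥ 10⁵ d`).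
[cite: KeevashLifshitz2023, Lemma 2.11] -/
theorem patExtSum_le_of_le {p : ℝ} (hp : 0 ≤ p) (h : 2 * p * d ≤ 1 / 2) : patExtSum d p ≤ 4 * p * d := by
  set x : ℝ := 2 * p * d with hx
  have hx0 : 0 ≤ x := by positivity
  have hx1 : x < 1 := by linarith
  have hgeom : ∑ m ∈ range (d + 1), x ^ m ≤ 1 / (1 - x) := by
    rw [geom_sum_eq hx1.ne (d + 1)]
    have h1 : 0 < 1 - x := by linarith
    rw [show (x ^ (d + 1) - 1) / (x - 1) = (1 - x ^ (d + 1)) / (1 - x) by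
      rw [← neg_sub 1 (x ^ (d + 1)), ← neg_sub 1 x, neg_div_neg_eq]]
    apply div_le_div_of_nonneg_right _ h1.le
    linarith [pow_nonneg hx0 (d + 1)]
  have := (one_add_patExtSum_le (d := d) hp).trans hgeom
  -- `1/(1−x) − 1 = x/(1−x) ≤ 2x`
  have h1 : 0 < 1 - x := by linarith
  have key : 1 / (1 - x) ≤ 1 + 2 * x := by
    rw [div_le_iff₀ h1]
    nlinarith
  linarith

/-! ## Lemma 2.11′: spread left-invariant kernels are almost lazy on pure degree `d` -/

/-- **Pointwise `p`-spread kernel**: `ν(a,b) ≤ ν(a,a) · p^{#{i : a_i ≠ b_i}}` (the form of Def. 2.10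
actually used in the proof of Lemma 2.14). [cite: KeevashLifshitz2023, Def. 2.10 and §2.6] -/
def IsSpread (ν : (Fin d ↪ α) → (Fin d ↪ α) → ℝ) (p : ℝ) : Prop :=
  ∀ a b, ν a b ≤ ν a a * p ^ moved a b

/-- One pattern class: `(Σ_{b ∈ cls a π} ν(a,b) g(b))² ≤ (ν(a,a) p^{m(π)})² (Σ_{b ∈ cls a π} g(b))²`
(the kernel is a constant `≤ ν(a,a) p^{m(π)}` on the class).
[cite: KeevashLifshitz2023, Lemmas 2.13/2.14] -/
theorem sq_classSum_kernel_le {ν : (Fin d ↪ α) → (Fin d ↪ α) → ℝ} {p : ℝ} (hν : IsLeftInvariant ν)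
    (h0 : ∀ a b, 0 ≤ ν a b) (hsp : IsSpread ν p) (g : (Fin d ↪ α) → ℝ) (a : Fin d ↪ α)
    (π : Fin d → Option (Fin d)) :
    (∑ b ∈ cls a π, ν a b * g b) ^ 2 ≤ (ν a a * p ^ mvp π) ^ 2 * (∑ b ∈ cls a π, g b) ^ 2 := by
  classical
  by_cases hne : (cls a π).Nonempty
  · obtain ⟨b₀, hb₀⟩ := hne
    have hc : ∀ b ∈ cls a π, ν a b = ν a b₀ := fun b hb =>
      kernel_eq_of_pat_eq hν ((mem_cls.1 hb).trans (mem_cls.1 hb₀).symm)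
    rw [sum_congr rfl (fun b hb => by rw [hc b hb]), ← mul_sum, mul_pow]
    have hb : ν a b₀ ≤ ν a a * p ^ mvp π := by
      rw [← moved_eq_mvp (mem_cls.1 hb₀)]; exact hsp a b₀
    exact mul_le_mul_of_nonneg_right (pow_le_pow_left₀ (h0 a b₀) hb 2) (sq_nonneg _)
  · rw [not_nonempty_iff_eq_empty.1 hne]
    simp

/-- Functions on tuples as Euclidean vectors (counting inner product). [cite: KeevashLifshitz2023, §2.4] -/
def vecT (f : (Fin d ↪ α) → ℝ) : EuclideanSpace ℝ (Fin d ↪ α) := WithLp.toLp 2 f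

omit [DecidableEq α] in
/-- `‖f‖² = Σ_a f(a)²`. [cite: KeevashLifshitz2023, §2.4] -/
theorem norm_vecT_sq (f : (Fin d ↪ α) → ℝ) : ‖vecT f‖ ^ 2 = ∑ a, f a ^ 2 := by
  rw [vecT, EuclideanSpace.norm_eq, Real.sq_sqrt (by positivity)]
  exact sum_congr rfl fun a _ => by simp [sq_abs]

omit [Fintype α] [DecidableEq α] in
/-- `vecT` is additive over finite sums. [cite: KeevashLifshitz2023, §2.4] -/
theorem vecT_sum {ι : Type*} (s : Finset ι) (F : ι → (Fin d ↪ α) → ℝ) :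
    vecT (fun a => ∑ i ∈ s, F i a) = ∑ i ∈ s, vecT (F i) := by
  unfold vecT
  rw [← WithLp.toLp_sum]
  congr 1
  funext a
  simp [Finset.sum_apply]

/-- **Lemma 2.11′ (off-diagonal `L²` bound).** For `ν ≥ 0` left-invariant and pointwise `p`-spread and
`g` of pure top degree, `Σ_a (Σ_{b ≠ a} ν(a,b) g(b))² ≤ (ν(a₀,a₀) · ε(d,p))² · Σ_b g(b)²`
("`‖T(ν) g − p_lazy g‖ ≤ ε p_lazy ‖g‖`"). [cite: KeevashLifshitz2023, Lemma 2.11] -/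
theorem sum_sq_offDiag_le {ν : (Fin d ↪ α) → (Fin d ↪ α) → ℝ} {p : ℝ} {g : (Fin d ↪ α) → ℝ}
    (hν : IsLeftInvariant ν) (h0 : ∀ a b, 0 ≤ ν a b) (hsp : IsSpread ν p) (hp : 0 ≤ p)
    (hg : IsPureTop g) (a₀ : Fin d ↪ α) :
    ∑ a, (∑ b ∈ univ.erase a, ν a b * g b) ^ 2 ≤ (ν a₀ a₀ * patExtSum d p) ^ 2 * ∑ b, g b ^ 2 := by
  classical
  set P : Finset (Fin d → Option (Fin d)) := univ.erase (fun i => some i) with hP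
  set F : (Fin d → Option (Fin d)) → (Fin d ↪ α) → ℝ := fun π a => ∑ b ∈ cls a π, ν a b * g b with hF
  -- Step 1: decomposition of the off-diagonal part by pattern classes
  have hdec : ∀ a, ∑ b ∈ univ.erase a, ν a b * g b = ∑ π ∈ P, F π a := by
    intro a
    have h := sum_cls_sum a (fun b => ν a b * g b)
    rw [← add_sum_erase _ _ (mem_univ (fun i : Fin d => some i)), cls_id, sum_singleton,
      ← add_sum_erase _ _ (mem_univ a)] at h
    linarith
  -- Step 2: each class vector is short
  have hδ : ∀ a, ν a a = ν a₀ a₀ := fun a => kernel_diag_eq hν a a₀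
  have h0' : 0 ≤ ν a₀ a₀ := h0 a₀ a₀
  have hcls : ∀ π, ‖vecT (F π)‖ ≤ ν a₀ a₀ * p ^ mvp π * ((ext π).card : ℝ) * ‖vecT g‖ := by
    intro π
    have hsq : ‖vecT (F π)‖ ^ 2 ≤ (ν a₀ a₀ * p ^ mvp π * ((ext π).card : ℝ) * ‖vecT g‖) ^ 2 := by
      rw [norm_vecT_sq, show (ν a₀ a₀ * p ^ mvp π * ((ext π).card : ℝ) * ‖vecT g‖) ^ 2 =
        (ν a₀ a₀ * p ^ mvp π) ^ 2 * (((ext π).card : ℝ) ^ 2 * ‖vecT g‖ ^ 2) by ring, norm_vecT_sq]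
      calc ∑ a, F π a ^ 2 ≤ ∑ a, (ν a a * p ^ mvp π) ^ 2 * (∑ b ∈ cls a π, g b) ^ 2 :=
            sum_le_sum fun a _ => sq_classSum_kernel_le hν h0 hsp g a π
        _ = (ν a₀ a₀ * p ^ mvp π) ^ 2 * ∑ a, (∑ b ∈ cls a π, g b) ^ 2 := by
            rw [mul_sum]
            exact sum_congr rfl fun a _ => by rw [hδ a]
        _ ≤ (ν a₀ a₀ * p ^ mvp π) ^ 2 * (((ext π).card : ℝ) ^ 2 * ∑ b, g b ^ 2) :=
            mul_le_mul_of_nonneg_left (sum_sq_classSum_le hg π) (sq_nonneg _)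
    have hR : 0 ≤ ν a₀ a₀ * p ^ mvp π * ((ext π).card : ℝ) * ‖vecT g‖ := by positivity
    exact (pow_le_pow_iff_left₀ (norm_nonneg _) hR two_ne_zero).1 hsq
  -- Step 3: Minkowski over the classes
  have hvec : vecT (fun a => ∑ b ∈ univ.erase a, ν a b * g b) = ∑ π ∈ P, vecT (F π) := by
    rw [← vecT_sum]
    congr 1
    funext a
    exact hdec a
  have hnorm : ‖vecT (fun a => ∑ b ∈ univ.erase a, ν a b * g b)‖ ≤
      ν a₀ a₀ * patExtSum d p * ‖vecT g‖ := by
    rw [hvec]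
    refine (norm_sum_le _ _).trans ?_
    calc ∑ π ∈ P, ‖vecT (F π)‖ ≤ ∑ π ∈ P, ν a₀ a₀ * p ^ mvp π * ((ext π).card : ℝ) * ‖vecT g‖ :=
          sum_le_sum fun π _ => hcls π
      _ = ν a₀ a₀ * patExtSum d p * ‖vecT g‖ := by
          rw [patExtSum, mul_sum, sum_mul]
          exact sum_congr rfl fun π _ => by ring
  have hR : 0 ≤ ν a₀ a₀ * patExtSum d p * ‖vecT g‖ := by
    have := patExtSum_nonneg d hp
    positivity
  have := (pow_le_pow_iff_left₀ (norm_nonneg _) hR two_ne_zero).2 hnorm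
  rw [norm_vecT_sq, mul_pow, norm_vecT_sq] at this
  exact this

/-- **Lemma 2.11′ (bilinear form).** `|Σ_a g(a) Σ_{b ≠ a} ν(a,b) g(b)| ≤ ν(a₀,a₀) · ε(d,p) · Σ_a g(a)²`.
[cite: KeevashLifshitz2023, Lemma 2.11 and proof of Lemma 2.9] -/
theorem abs_offDiag_form_le {ν : (Fin d ↪ α) → (Fin d ↪ α) → ℝ} {p : ℝ} {g : (Fin d ↪ α) → ℝ}
    (hν : IsLeftInvariant ν) (h0 : ∀ a b, 0 ≤ ν a b) (hsp : IsSpread ν p) (hp : 0 ≤ p)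
    (hg : IsPureTop g) (a₀ : Fin d ↪ α) :
    |∑ a, g a * ∑ b ∈ univ.erase a, ν a b * g b| ≤ ν a₀ a₀ * patExtSum d p * ∑ a, g a ^ 2 := by
  have hcs := sum_mul_sq_le_sq_mul_sq univ g (fun a => ∑ b ∈ univ.erase a, ν a b * g b)
  have h2 := sum_sq_offDiag_le hν h0 hsp hp hg a₀
  have hε : 0 ≤ ν a₀ a₀ * patExtSum d p := mul_nonneg (h0 a₀ a₀) (patExtSum_nonneg d hp)
  have hG : 0 ≤ ∑ a, g a ^ 2 := sum_nonneg fun a _ => sq_nonneg _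
  have hsq : (∑ a, g a * ∑ b ∈ univ.erase a, ν a b * g b) ^ 2 ≤
      (ν a₀ a₀ * patExtSum d p * ∑ a, g a ^ 2) ^ 2 := by
    calc (∑ a, g a * ∑ b ∈ univ.erase a, ν a b * g b) ^ 2
        ≤ (∑ a, g a ^ 2) * ∑ a, (∑ b ∈ univ.erase a, ν a b * g b) ^ 2 := hcs
      _ ≤ (∑ a, g a ^ 2) * ((ν a₀ a₀ * patExtSum d p) ^ 2 * ∑ b, g b ^ 2) :=
          mul_le_mul_of_nonneg_left h2 hG
      _ = (ν a₀ a₀ * patExtSum d p * ∑ a, g a ^ 2) ^ 2 := by ring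
  exact abs_le_of_sq_le_sq hsq (by positivity)

/-- **Lemma 2.11′ / the junta bound in the form Lemma 2.9 consumes**: for `ν ≥ 0` left-invariant and
pointwise `p`-spread and `g` of pure top degree,
`Σ_{a,b} ν(a,b) g(a) g(b) ≥ (1 − ε(d,p)) · ν(a₀,a₀) · Σ_a g(a)²`, i.e.
`⟨T(ν) g, g⟩ ≥ (1 − ε) p_lazy ‖g‖₂²` in the paper's normalisation.
[cite: KeevashLifshitz2023, Lemma 2.11 and proof of Lemma 2.9 (`⟨Tg, g⟩ ≥ .9 p_lazy ‖g‖²`)] -/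
theorem quadratic_form_ge {ν : (Fin d ↪ α) → (Fin d ↪ α) → ℝ} {p : ℝ} {g : (Fin d ↪ α) → ℝ}
    (hν : IsLeftInvariant ν) (h0 : ∀ a b, 0 ≤ ν a b) (hsp : IsSpread ν p) (hp : 0 ≤ p)
    (hg : IsPureTop g) (a₀ : Fin d ↪ α) :
    (1 - patExtSum d p) * ν a₀ a₀ * ∑ a, g a ^ 2 ≤ ∑ a, ∑ b, ν a b * (g a * g b) := by
  classical
  have hsplit : ∑ a, ∑ b, ν a b * (g a * g b) =
      ν a₀ a₀ * ∑ a, g a ^ 2 + ∑ a, g a * ∑ b ∈ univ.erase a, ν a b * g b := by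
    rw [mul_sum, ← sum_add_distrib]
    refine sum_congr rfl fun a _ => ?_
    rw [← add_sum_erase _ _ (mem_univ a), kernel_diag_eq hν a a₀, mul_sum]
    congr 1
    · ring
    · exact sum_congr rfl fun b _ => by ring
  rw [hsplit]
  have h := abs_offDiag_form_le hν h0 hsp hp hg a₀
  have := neg_abs_le (∑ a, g a * ∑ b ∈ univ.erase a, ν a b * g b)
  nlinarith

end Tuple

end Literature.Combinatorics.Additive.KeevashLifshitz

end
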